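import Summits.HodgeConjecture.HodgeConjecture.Theses.MirrorBraneLift

/-!
# Line `formalseed` — a FORMAL (linearly spreading) seed cycle at ANY member + linear spread + isogeny seam

Alternative skeleton for the crux `TropicalWeilSupply` of route `MirrorBraneLift` (item
`stmt-HodgeConjecture-18676`; decl `Summit.HodgeConjecture.HodgeConjecture.Theses.MirrorBraneLift.TropicalWeilSupply`,
FIXED and concluded BY NAME below). Registered by the crux-strategist seat alongside `Lines/birth.lean`
(never edited here); stubs 3–4 are BYTE-IDENTICAL restatements of birth's `DenseIsogenyOrbit` /
`IsogenyTransport`, so one proof closes them in both lines.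

## The re-cut (why this is not `birth` again)

`birth` isolates the research content as `PointSupply`: a cycle with non-zero Weil functional at ONE
VERY GENERAL member `P₀` (transcendental period matrix), and spreads it by `OpenNearVeryGeneral`
(algebraic independence ⇒ the rational linear realisation system is solvable identically). Here the
transcendence is moved OUT of the research stub and INTO a finite certificate:

* `SpreadsLinearly δ Z` (a `Prop` about ONE effective cycle `Z` on ONE member, typically a RATIONAL /
  CM / split member where effective cycles with non-zero Weil functional are plentiful — flat subtori):
  the LINEAR part of the certificate equations of the discrete type of `Z` (edges in the frame
  directions, `vertex_succ_sub`; facet matchings with period shifts, `facet_eq`) — with `Z`'s weights,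
  integer frames, facet classes, permutations and integer shifts frozen — has a real solution over EVERY
  symmetric `Q` with `J Q` antisymmetric, i.e. over the whole linear span `L_δ(n) ≅ ℝ^{n²}` of the Weil
  family. The system is homogeneous linear in `(vertices, refFacets, edgeCoeffs, Q)` jointly, so this
  says: the projection of its solution space onto `L_δ(n)` is ONTO — a RANK condition on an explicit
  integer matrix, decidable by exact linear algebra for any given `Z` (Kontsevich's "formal tropical
  cycle with vertices in `Γ₂ ⊗ Γ_p`", Zharkov 2020 p. 3, made finite).
* `stub_seedSupply` (THE BET, re-cut; XL): for every `n ≥ 2`, `δ ≥ 1` SOME member `P₀` (any member —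
  no very-generality) carries an effective cycle `Z₀` with `functional δ Z₀ ≠ 0` AND `SpreadsLinearly δ Z₀`.
  Per `(n, δ)` this is a finite certificate (rational `Q₀`, the cells, and `n²` rational solutions of the
  linear system, one per coordinate direction of `L_δ(n)`), checkable in Lean by `norm_num`/`decide`
  once exhibited; it is EQUIVALENT to the crux for that `(n, δ)` (⇐: a witness at a very general member
  spreads linearly, because the solvability locus is a `ℚ`-subspace of `L_δ(n)` containing a point with
  algebraically independent coordinates), so nothing is lost and the search space is now enumerable
  (types of bounded complexity at a fixed rational member, e.g. the CM point `Q₀ = diag(δ·1, 1)`,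
  `B = Eⁿ`).
* `stub_linearSpread` (TRUE; size M/L): `functional δ Z₀ ≠ 0 ∧ SpreadsLinearly δ Z₀` at `P₀` ⇒ an open
  `U ∋ P₀.Q` all of whose members carry supply. Proof: the solution space `S ⊆ L_δ(n) × Data` is a linear
  subspace projecting ONTO `L_δ(n)`; pick a linear section `s` (`LinearMap.exists_rightInverse_of_surjective`);
  `data(P) := data(Z₀) + s(P.Q - P₀.Q)` solves the equations at `P.Q` (every `Polarization` has
  `P.Q ∈ L_δ(n)`: `PosDef ⇒ IsHermitian = IsSymm` over `ℝ`, and `skew`); weights / frames / saturation /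
  facet data / `balanced` are copied from `Z₀`; `det (edgeCoeff σ) > 0` and `functional ≠ 0` persist on a
  neighbourhood by continuity of `det` (finitely many cells). No algebraic independence anywhere.
* `stub_denseIsogenyOrbit`, `stub_isogenyTransport` (TRUE; M/L and L): as in `birth` (rational points
  of the commutant of `J` are dense and act transitively on `𝓛_δ⁺` by congruence; push–pull of
  certificate cycles along `x ↦ hx`, `hJ = Jh`, and homotheties multiplies the functional by a non-zero
  constant).

`TropicalWeilSupply_of` (sorry-free): seed at `P₀` ⇒ open `U ∋ P₀.Q` of supply ⇒ the dense isogeny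
orbit of an arbitrary member `P` meets `U` in `P' = t·hPhᵀ` ⇒ transport supply from `P'` to `P`.
As in `birth`, the very-generality binder of the crux is not consumed (supply at every member is
equivalent to the crux, by generic spread).

## What the re-cut buys (strategist's card `Lines/formalseed.md` has the details)

1. A per-`(n, δ)` DECIDABLE research target and a BC5-style first rung: `(n, δ) = (2, 1)` = "exhibit one
   formal tropical Weil surface for Zharkov's family `Q_{a,b,c,e}`" (the prior programme's 148-cell
   surface of class `4θ + 2w₁` is such a certificate if recovered; a kit search over refinements of flat
   configurations at `E × E` is the cheap route to it).
2. CLASS-LEVEL SEEDS EXIST FOR ALL `n` (strategist's observation, idea `Ideas/cm-point-seeds.md`): at the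
   CM point `B = Eⁿ`, `E = ℝ²/(δℤ ⊕ ℤ)`, a positive integer combination of FLAT product subtori has class
   `N·θⁿ + w` with `w ≠ 0` on the Weil plane (the `(1,…,1)`-Künneth piece of `θⁿ` is `n!·I^{⊗n}`, an
   interior point of the fully separable cone of `(Sym₂ℝ²)^{⊗n}`, and the Weil line lies in that piece).
   So every failure of the crux is DEFORMATION-theoretic: such a flat configuration never spreads
   linearly as it stands (first-order rigidity of flat subtori, of products of tropical curves, and of
   Lagrangian connect-sums of conormal tori — card §Rigidity), and the whole question is whether a
   REFINEMENT / smoothing of it does. `stub_seedSupply` is exactly "some smoothing spreads".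
3. The negative side gets the same finite format: `¬ stub_seedSupply` at `(4, 1)` restricted to types of
   bounded complexity is a finite computation, and `TropicalWeilVanishing` (sibling route) ⟺ no type at
   all spreads for `(4, 1)`.

Disproof used: none exists on this crux (no `Disproof.lean`; the landed Negative lemma
`Theorems/TropicalWeilSupply/Negative/FalseOfTropicalWeilVanishing.lean` is the dichotomy with the
sibling crux and constrains no stub here). Dead lines: none recorded.
-/

namespace Summit.HodgeConjecture.HodgeConjecture.Cruxes.TropicalWeilSupply.FormalSeed

open scoped Matrix
open Summit.HodgeConjecture.HodgeConjecture.Theses.MirrorBraneLift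

/-- **The certificate predicate.** The discrete type of the effective cycle `Z` (weights, integer frames,
facet classes, facet permutations, integer facet shifts — all frozen) is LINEARLY REALISABLE over the
whole linear span `L_δ(n) = {Q symmetric, J Q antisymmetric}` of the Weil family: for every such `Q`
(positive or not) the homogeneous linear certificate equations `vertex_succ_sub` and `facet_eq` of
`TropicalTorusCycle` have a real solution `(vertex, refFacet, edgeCoeff)`. Equivalently the solution
space of the joint linear system in `(vertex, refFacet, edgeCoeff, Q)` projects ONTO `L_δ(n)` — a rank
condition on an integer matrix (Kontsevich's formal cycles, vertices linear in the parameters).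
[cite: Zharkov2020TropicalWeil, §2 (pp. 2–4)] [cite: MikhalkinZharkov2014Eigenwave, Def. 4.2] -/
def SpreadsLinearly {n : ℕ} (δ : ℕ) {Q₀ : Matrix (Fin (2 * n)) (Fin (2 * n)) ℝ}
    (Z : Literature.AlgebraicGeometry.Tropical.TropicalTorusCycle (2 * n) n Q₀) : Prop :=
  ∀ Q : Matrix (Fin (2 * n)) (Fin (2 * n)) ℝ, Q.IsSymm →
    (Literature.AlgebraicGeometry.Tropical.WeilFamily.J n δ * Q)ᵀ =
      -(Literature.AlgebraicGeometry.Tropical.WeilFamily.J n δ * Q) →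
    ∃ (vertex : Fin Z.numCells → Fin (n + 1) → Fin (2 * n) → ℝ)
      (refFacet : Fin Z.numFacetClasses → Fin n → Fin (2 * n) → ℝ)
      (edgeCoeff : Fin Z.numCells → Matrix (Fin n) (Fin n) ℝ),
      (∀ (σ : Fin Z.numCells) (j : Fin n) (a : Fin (2 * n)),
          vertex σ j.succ a - vertex σ 0 a = ∑ m, ((Z.cell σ).frame a m : ℝ) * edgeCoeff σ m j) ∧
      (∀ (σ : Fin Z.numCells) (i : Fin (n + 1)) (j : Fin n) (a : Fin (2 * n)),
          vertex σ (i.succAbove (Z.facetPerm σ i j)) a =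
            refFacet (Z.facetClass σ i) j a + ∑ b, Q a b * (Z.facetShift σ i b : ℝ))

/-- **Stub 1 statement — formal seed supply (the bet, certificate form).** For every `n ≥ 2`, `δ ≥ 1`
some member `P₀ ∈ 𝓛_δ⁺` (ANY member: rational, CM or split allowed) carries an effective tropical
`n`-cycle with non-zero `ℚ(√-δ)`-Weil functional whose discrete type spreads linearly over `L_δ(n)`.
Equivalent to the crux for each `(n, δ)`; known only for `n = 2`, `δ = 1` (prior programme's formal
surface, not in the tree); expected false at `(4, 1)` by Kontsevich–Zharkov.
[cite: Zharkov2020TropicalWeil, §2 (pp. 2–4)] [cite: MikhalkinZharkov2014Eigenwave, Thm. 5.4] -/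
def SeedSupply : Prop :=
  ∀ (n : ℕ), 2 ≤ n → ∀ (δ : ℕ), 1 ≤ δ →
    ∃ (P₀ : Literature.AlgebraicGeometry.Tropical.WeilFamily.Polarization n δ)
      (Z₀ : Literature.AlgebraicGeometry.Tropical.TropicalTorusCycle (2 * n) n P₀.Q),
      Literature.AlgebraicGeometry.Tropical.WeilFamily.functional δ Z₀ ≠ 0 ∧ SpreadsLinearly δ Z₀

/-- **Stub 2 statement — linear spread (TRUE).** A linearly spreading effective cycle with non-zero Weil
functional at a member `P₀` yields supply at every member whose period matrix lies in some open
neighbourhood of `P₀.Q` (linear section of the solution space through the data of `Z₀`; positivity of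
`det edgeCoeff` and `functional ≠ 0` are open conditions; every member's `Q` is symmetric and `J`-skew).
[cite: Zharkov2020TropicalWeil, §2 (pp. 2–4)] [cite: MikhalkinZharkov2014Eigenwave, Def. 4.2] -/
def LinearSpread : Prop :=
  ∀ (n δ : ℕ), 1 ≤ δ → ∀ (P₀ : Literature.AlgebraicGeometry.Tropical.WeilFamily.Polarization n δ)
    (Z₀ : Literature.AlgebraicGeometry.Tropical.TropicalTorusCycle (2 * n) n P₀.Q),
    Literature.AlgebraicGeometry.Tropical.WeilFamily.functional δ Z₀ ≠ 0 → SpreadsLinearly δ Z₀ →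
    ∃ U : Set (Matrix (Fin (2 * n)) (Fin (2 * n)) ℝ), IsOpen U ∧ P₀.Q ∈ U ∧
      ∀ P : Literature.AlgebraicGeometry.Tropical.WeilFamily.Polarization n δ, P.Q ∈ U →
        ∃ Z : Literature.AlgebraicGeometry.Tropical.TropicalTorusCycle (2 * n) n P.Q,
          Literature.AlgebraicGeometry.Tropical.WeilFamily.functional δ Z ≠ 0

/-- **Stub 3 statement — dense isogeny orbits (TRUE; verbatim `birth`'s `DenseIsogenyOrbit`).**
[cite: vanGeemen1994HodgeAV, §5.2–5.3] [cite: MikhalkinZharkov2014Eigenwave, Def. 6.1] -/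
def DenseIsogenyOrbit : Prop :=
  ∀ (n δ : ℕ), 1 ≤ δ → ∀ (P : Literature.AlgebraicGeometry.Tropical.WeilFamily.Polarization n δ)
    (U : Set (Matrix (Fin (2 * n)) (Fin (2 * n)) ℝ)), IsOpen U →
    (∃ P₁ : Literature.AlgebraicGeometry.Tropical.WeilFamily.Polarization n δ, P₁.Q ∈ U) →
    ∃ (P' : Literature.AlgebraicGeometry.Tropical.WeilFamily.Polarization n δ)
      (h : Matrix (Fin (2 * n)) (Fin (2 * n)) ℤ) (t : ℝ),
      0 < t ∧ h.det ≠ 0 ∧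
      h.map ((↑) : ℤ → ℝ) * Literature.AlgebraicGeometry.Tropical.WeilFamily.J n δ =
        Literature.AlgebraicGeometry.Tropical.WeilFamily.J n δ * h.map ((↑) : ℤ → ℝ) ∧
      P'.Q = t • (h.map ((↑) : ℤ → ℝ) * P.Q * (h.map ((↑) : ℤ → ℝ))ᵀ) ∧ P'.Q ∈ U

/-- **Stub 4 statement — isogeny / homothety transport of supply (TRUE; verbatim `birth`'s
`IsogenyTransport`).** [cite: MikhalkinZharkov2014Eigenwave, Def. 4.2 and Prop. 4.3]
[cite: Zharkov2020TropicalWeil, §2 (pp. 2–4)] -/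
def IsogenyTransport : Prop :=
  ∀ (n δ : ℕ), 1 ≤ δ → ∀ (P P' : Literature.AlgebraicGeometry.Tropical.WeilFamily.Polarization n δ)
    (h : Matrix (Fin (2 * n)) (Fin (2 * n)) ℤ) (t : ℝ), 0 < t → h.det ≠ 0 →
    h.map ((↑) : ℤ → ℝ) * Literature.AlgebraicGeometry.Tropical.WeilFamily.J n δ =
      Literature.AlgebraicGeometry.Tropical.WeilFamily.J n δ * h.map ((↑) : ℤ → ℝ) →
    P'.Q = t • (h.map ((↑) : ℤ → ℝ) * P.Q * (h.map ((↑) : ℤ → ℝ))ᵀ) →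
    (∃ Z' : Literature.AlgebraicGeometry.Tropical.TropicalTorusCycle (2 * n) n P'.Q,
        Literature.AlgebraicGeometry.Tropical.WeilFamily.functional δ Z' ≠ 0) →
    ∃ Z : Literature.AlgebraicGeometry.Tropical.TropicalTorusCycle (2 * n) n P.Q,
      Literature.AlgebraicGeometry.Tropical.WeilFamily.functional δ Z ≠ 0

/-- Stub 1 — formal seed supply: THE BET in certificate form (XL; finite and decidable per `(n, δ)`).
[cite: Zharkov2020TropicalWeil, §2 (pp. 2–4)] -/
theorem stub_seedSupply : SeedSupply := by
  sorry

/-- Stub 2 — linear spread (M/L; linear right inverse + continuity of `det`, no transcendence).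
[cite: MikhalkinZharkov2014Eigenwave, Def. 4.2] -/
theorem stub_linearSpread : LinearSpread := by
  sorry

/-- Stub 3 — dense isogeny orbits (M/L; same statement as `birth`). [cite: vanGeemen1994HodgeAV, §5.2–5.3] -/
theorem stub_denseIsogenyOrbit : DenseIsogenyOrbit := by
  sorry

/-- Stub 4 — isogeny / homothety transport (L; same statement as `birth`).
[cite: MikhalkinZharkov2014Eigenwave, Def. 4.2 and Prop. 4.3] -/
theorem stub_isogenyTransport : IsogenyTransport := by
  sorry

/-! ## Name-keyed aliases of the four statements (device of `Lines/birth.lean`: the native skeleton audit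
admits a hypothesis of the skeleton theorem iff its head constant is named like a declared stub). -/
namespace __Registered

/-- Alias of `SeedSupply` keyed by the registered stub name. -/
abbrev stub_seedSupply : Prop := SeedSupply
/-- Alias of `LinearSpread` keyed by the registered stub name. -/
abbrev stub_linearSpread : Prop := LinearSpread
/-- Alias of `DenseIsogenyOrbit` keyed by the registered stub name. -/
abbrev stub_denseIsogenyOrbit : Prop := DenseIsogenyOrbit
/-- Alias of `IsogenyTransport` keyed by the registered stub name. -/
abbrev stub_isogenyTransport : Prop := IsogenyTransport

end __Registered

/-- **Composition (real proof) — THE SKELETON THEOREM.** A formal seed at some member `P₀` (stub 1)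
spreads to an open `U ∋ P₀.Q` of supply (stub 2); the isogeny orbit of an arbitrary member `P` is dense,
so some `P' = t·hPhᵀ ∈ U` (stub 3) carries supply, which transports back to `P` (stub 4). Concludes the
route decl `TropicalWeilSupply` BY NAME; the very-generality binder is not consumed. -/
theorem TropicalWeilSupply_of :
    __Registered.stub_seedSupply → __Registered.stub_linearSpread →
      __Registered.stub_denseIsogenyOrbit → __Registered.stub_isogenyTransport → TropicalWeilSupply := by
  intro h₁ h₂ h₃ h₄ n hn δ hδ P _hP
  obtain ⟨P₀, Z₀, hW, hS⟩ := h₁ n hn δ hδ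
  obtain ⟨U, hUo, hP₀U, hU⟩ := h₂ n δ hδ P₀ Z₀ hW hS
  obtain ⟨P', h, t, ht, hdet, hJ, hQ, hP'U⟩ := h₃ n δ hδ P U hUo ⟨P₀, hP₀U⟩
  exact h₄ n δ hδ P P' h t ht hdet hJ hQ (hU P' hP'U)

/-- **The crux, closed modulo exactly the four registered stubs** (sanity: the stubs compose). -/
theorem TropicalWeilSupply_of_stubs : TropicalWeilSupply :=
  TropicalWeilSupply_of stub_seedSupply stub_linearSpread stub_denseIsogenyOrbit stub_isogenyTransport

end Summit.HodgeConjecture.HodgeConjecture.Cruxes.TropicalWeilSupply.FormalSeed
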